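import Literature.AlgebraicTopology.CharacteristicClasses.ProjectiveLineTangentCocycle
import Literature.AlgebraicTopology.CharacteristicClasses.LineThomClassGluing
import Literature.AlgebraicTopology.SingularHomology.CohomologyHomotopyInvariance
import Literature.Geometry.Symplectic.FirstChernClassComplexFraming
import Literature.Geometry.Symplectic.SymplecticSplittingIso
import Literature.Geometry.Symplectic.JSphereFamilyLeafFunction
import Literature.Geometry.Symplectic.JSphereLocalFoliationUniqueness
import Mathlib.Geometry.Manifold.ContMDiffMFDeriv
import Mathlib.Topology.Homotopy.Basic
import HarnessLib

/-!
# An immersed `J`-holomorphic sphere with a transverse field is not null-homotopic; the uniqueness clause of the Hofer–Lizan–Sikorav local foliation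

Support theorems (no new named fact, D-0026) for the uniqueness clause of
`Literature.Geometry.Symplectic.hls_localFoliation_embeddedSphere_trivialNormal`
(`JSphereLocalFoliation.lean`; Wendl 2018, Prop. 2.53 with Thm. 2.49). The theorem
`Literature.Geometry.Symplectic.hls_uniqueness_of_localFamily` (`JSphereLocalFoliationUniqueness.lean`)
proves that clause from the family data under the extra hypothesis that the competing sphere `u`
is not constant. Here that hypothesis is REMOVED (`hls_uniqueness_of_localFamily'`): a constant
two-chart sphere has a constant glued map `F`, and `F ≃ F₀` would make the glued map `F₀` of the
central leaf null-homotopic — impossible, because the leaf is an immersed `J`-holomorphic sphere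
sitting in a smooth family, so `F₀^*(TX, J) ≅ ℂ̲ ⊕ 𝒪(2)` has `c₁ ≠ 0`. This is the `c₁`-content
of the printed proof (Wendl 2018, proof of Prop. 2.53: the leaves are embedded spheres with
`[S] · [S] = 0`, so `c₁([S]) = χ(S²) + [S] · [S] = 2` by the adjunction formula, Thm. 2.51;
McDuff–Salamon 2017, Thm. 2.7.1: `c₁` is a homotopy invariant of the bundle and vanishes on
trivial bundles), organised as follows.

* `JSphereNullHomotopy.not_homotopic_const`: let `(u, v)` be a `C¹` two-chart sphere
  (`v z = u z⁻¹`) with `u` `J`-holomorphic, glued map `F₀ : ℂℙ¹ → X`, and `ξu`, `ξv` continuous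
  tangent fields along `u`, `v` with `ξv w = ξu w⁻¹`, such that `ξ` and the tangent vector
  `du(1)` (resp. `dv(1)`) are independent over the `J`-complex scalars
  (`JSphereNullHomotopy.jsmul`). Then `F₀` is not null-homotopic. PROOF: the tangent vectors
  `du_z(1)` and `dv_w(1) = (-z²) ·_J du_z(1)` (`mfderiv_v_apply_one`, chain rule and
  `J`-linearity of `du`) transform by the cocycle `-1/w²` of the line bundle `𝒪(2) → ℂℙ¹`
  (`Literature.AlgebraicTopology.CharacteristicClasses.ProjectiveLineTangentCocycle.bundle`), so
  `(a, ℓ) ↦ a ·_J ξ + ℓ ·_J du(1)` is a well-defined fibrewise `ℂ`-linear bijection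
  `ℂ̲ ⊕ 𝒪(2) → F₀^*(TX, J)` (`fibreEquiv`); it is continuous on total spaces (`continuous_forward`:
  locally a combination with continuous coefficients of two continuous sections, read in a
  trivialisation of `(TX, J)`), hence an isomorphism of complex vector bundles (`splitIso`,
  backward continuity by Husemoller's criterion `continuous_totalSpace_symm`). By (C₁), the Whitney
  sum formula and `c₁(ℂ̲) = 0`, `c₁(F₀^*(TX, J)) = c₁(𝒪(2)) ≠ 0`
  (`ProjectiveLineTangentCocycle.chernClassZ_one_bundle_ne_zero`), whereas naturality and homotopy
  invariance give `c₁(F₀^*(TX, J)) = F₀^* c₁(TX, J) = const^* c₁(TX, J) = 0` for `F₀ ≃ const`.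
* `JSphereNullHomotopy.not_homotopic_const_of_family`: for a smooth family `(U a, V a)_{|a|<ε}` of
  immersed `J`-holomorphic two-chart spheres with jointly immersive parametrisations
  `Φ_U(a, z) = U a z`, `Φ_V(a, w) = V a w` (the data in the conclusion of the HLS fact), the field
  `ξu z := dΦ_U(0, z)(1, 0)` qualifies: it is continuous (`continuous_paramLift`, continuity of
  the tangent map), glues (`paramLift_glue`, chain rule for `Φ_V(a, w) = Φ_U(a, w⁻¹)`), and is
  `J`-independent from the tangent direction (`indep_of_injective_mfderiv`: the complex line
  `ℂ ·_J ∂_zΦ = dΦ({0} × ℂ)` misses `dΦ(1, 0)` by injectivity of `dΦ`).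
* `hls_uniqueness_of_localFamily'`: the uniqueness clause exactly as in the fact, from the
  family data alone.

## References

* C. Wendl, *Holomorphic Curves in Low Dimensions*, LNM 2216, Springer (2018), Prop. 2.53 (proof),
  Thm. 2.49, Thm. 2.51. [Wendl2018]
* D. McDuff, D. Salamon, *Introduction to Symplectic Topology*, 3rd ed., OUP (2017), §2.7,
  Thm. 2.7.1. [McDuffSalamon2017]
* D. Husemoller, *Fibre Bundles*, 3rd ed., GTM 20, Springer (1994), Ch. 3 Thm. 2.5; Ch. 17 §3.
  [HusemollerFibreBundles1994]
* H. Hofer, V. Lizan, J.-C. Sikorav, *On genericity for holomorphic curves in four-dimensional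
  almost-complex manifolds*, J. Geom. Anal. 7 (1998) 149–159. [HoferLizanSikorav1997]
-/


noncomputable section

open scoped Manifold ContDiff Topology
open Set Function Filter Bundle Module Complex
open Literature.AlgebraicTopology.SingularHomology Literature.AlgebraicTopology.CharacteristicClasses
  Literature.AlgebraicTopology.CharacteristicClasses.ProjectiveLineTangentCocycle
  Literature.Topology.FourManifolds Literature.Topology.FourManifolds.ComplexProjectiveSpace

namespace Literature.Geometry.Symplectic

open ComplexVectorBundle Metric

namespace JSphereNullHomotopy

variable {X : Type} [TopologicalSpace X]
  [ChartedSpace (EuclideanSpace ℝ (Fin 4)) X] [IsManifold (𝓡 4) ∞ X]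
  (JX : AlmostComplexStructure (𝓡 4) ∞ X)

/-! ### `J`-complex scalars on tangent vectors and the fibres of the complex tangent bundle -/

/-- The `J`-complex scalar multiplication `c · w = (re c) w + (im c) J_x w` on `T_x X`. [folklore] -/
def jsmul (x : X) (c : ℂ) (w : TangentSpace (𝓡 4) x) : TangentSpace (𝓡 4) x :=
  c.re • w + c.im • JX x w

/-- Unfolding `jsmul`. [folklore] -/
theorem jsmul_apply (x : X) (c : ℂ) (w : TangentSpace (𝓡 4) x) :
    jsmul JX x c w = c.re • w + c.im • JX x w := rfl

/-- `1 · w = w`. [folklore] -/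
theorem jsmul_one (x : X) (w : TangentSpace (𝓡 4) x) : jsmul JX x 1 w = w := by
  simp [jsmul_apply]

/-- `(c + d) · w = c · w + d · w`. [folklore] -/
theorem jsmul_add_left (x : X) (c d : ℂ) (w : TangentSpace (𝓡 4) x) :
    jsmul JX x (c + d) w = jsmul JX x c w + jsmul JX x d w := by
  simp only [jsmul_apply, Complex.add_re, Complex.add_im, add_smul]
  abel

/-- The real-linear identification `β_x⁻¹ : (ℂᵏ fibre) ≅ T_x X` intertwines complex scalars with
`J`-complex scalars. [folklore] -/
theorem fiberEquiv_smul (x : X) (c : ℂ) (z : JX.complexTangentCore.Fiber x) :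
    JX.complexTangentCore_fiberEquiv x (c • z) = jsmul JX x c (JX.complexTangentCore_fiberEquiv x z) := by
  rw [AlmostComplexStructure.complex_smul_eq_re_add_im c z, map_add,
    (JX.complexTangentCore_fiberEquiv x).map_smul, (JX.complexTangentCore_fiberEquiv x).map_smul,
    JX.complexTangentCore_fiberEquiv_I]
  rfl

/-- The inverse fibre identification `β_x⁻¹` intertwines `jsmul` with the `ℂ`-scalars. [folklore] -/
theorem fiberEquiv_symm_jsmul (x : X) (c : ℂ) (w : TangentSpace (𝓡 4) x) :
    (JX.complexTangentCore_fiberEquiv x).symm (jsmul JX x c w) =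
      c • (JX.complexTangentCore_fiberEquiv x).symm w := by
  apply (JX.complexTangentCore_fiberEquiv x).injective
  rw [ContinuousLinearEquiv.apply_symm_apply, fiberEquiv_smul, ContinuousLinearEquiv.apply_symm_apply]

/-- The inverse tangent homeomorphism on a fibre. [folklore] -/
theorem tangentHomeomorph_symm_apply (x : X) (w : TangentSpace (𝓡 4) x) :
    JX.tangentHomeomorph.symm (⟨x, w⟩ : TangentBundle (𝓡 4) X) =
      ⟨x, (JX.complexTangentCore_fiberEquiv x).symm w⟩ := by
  apply JX.tangentHomeomorph.injective
  rw [Homeomorph.apply_symm_apply, AlmostComplexStructure.tangentHomeomorph_apply_mk,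
    ContinuousLinearEquiv.apply_symm_apply]

/-- `fiberEquiv_symm_jsmul` with the base point of the scalar action transported along an
equality of points. [folklore] -/
theorem fiberEquiv_symm_jsmul' {x y : X} (h : x = y) (c : ℂ) (w : TangentSpace (𝓡 4) x) :
    (JX.complexTangentCore_fiberEquiv y).symm (jsmul JX x c w) =
      c • (JX.complexTangentCore_fiberEquiv y).symm w := by
  subst h
  exact fiberEquiv_symm_jsmul JX x c w

/-- The differential of a `J`-holomorphic map is `J`-complex-linear: `du(c) = c · du(1)`. [folklore] -/
theorem mfderiv_apply_eq_jsmul {u : ℂ → X} (hJu : IsJHolomorphic (𝓡 4) (fun y => JX y) u) (z c : ℂ) :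
    mfderiv 𝓘(ℝ, ℂ) (𝓡 4) u z c = jsmul JX (u z) c (mfderiv 𝓘(ℝ, ℂ) (𝓡 4) u z (1 : ℂ)) := by
  set L : ℂ →L[ℝ] EuclideanSpace ℝ (Fin 4) := mfderiv 𝓘(ℝ, ℂ) (𝓡 4) u z with hL
  have hJ : L (Complex.I * 1) = JX (u z) (L 1) := hJu z 1
  have hc : (c : ℂ) = (c.re : ℝ) • (1 : ℂ) + (c.im : ℝ) • (Complex.I * 1 : ℂ) := by
    apply Complex.ext <;> simp
  change L c = jsmul JX (u z) c (L 1)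
  rw [hc, L.map_add, L.map_smul, L.map_smul, hJ, jsmul_apply]
  simp only [Complex.real_smul, Complex.mul_re, Complex.ofReal_re, Complex.one_re, Complex.ofReal_im,
    Complex.one_im, Complex.mul_im, Complex.I_re, Complex.I_im, Complex.add_re, Complex.add_im]
  norm_num
  rfl

/-! ### The data: a two-chart sphere with a transverse field -/

variable {u v : ℂ → X} {ξu ξv : ℂ → EuclideanSpace ℝ (Fin 4)} {F₀ : C(ComplexProjectiveSpace 1, X)}

/-- The tangent frame of the chart `k`: `du(∂_z)` (`k = 0`) resp. `dv(∂_w)` (`k = 1`), read at the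
affine coordinate of `p`. [folklore] -/
def frame (u v : ℂ → X) (k : Fin (1 + 1)) (p : ComplexProjectiveSpace 1) : EuclideanSpace ℝ (Fin 4) :=
  if k = 0 then mfderiv 𝓘(ℝ, ℂ) (𝓡 4) u (coord 0 p) (1 : ℂ) else mfderiv 𝓘(ℝ, ℂ) (𝓡 4) v (coord 1 p) (1 : ℂ)

open Classical in
/-- The transverse field read at `p`. [folklore] -/
def field (ξu ξv : ℂ → EuclideanSpace ℝ (Fin 4)) (p : ComplexProjectiveSpace 1) : EuclideanSpace ℝ (Fin 4) :=
  if CoordNeZero 0 p then ξu (coord 0 p) else ξv (coord 1 p)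

omit [IsManifold (𝓡 4) ∞ X] in
/-- The frame of the chart `0`. [folklore] -/
theorem frame_zero (p : ComplexProjectiveSpace 1) :
    frame u v 0 p = mfderiv 𝓘(ℝ, ℂ) (𝓡 4) u (coord 0 p) (1 : ℂ) :=
  if_pos rfl

omit [IsManifold (𝓡 4) ∞ X] in
/-- The frame of the chart `1`. [folklore] -/
theorem frame_one (p : ComplexProjectiveSpace 1) :
    frame u v 1 p = mfderiv 𝓘(ℝ, ℂ) (𝓡 4) v (coord 1 p) (1 : ℂ) :=
  if_neg (by decide)

open Classical in
/-- The field on the chart `0`. [folklore] -/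
theorem field_of_coordNeZero {p : ComplexProjectiveSpace 1} (hp : CoordNeZero 0 p) :
    field ξu ξv p = ξu (coord 0 p) := by
  unfold field; rw [if_pos hp]

open Classical in
/-- The field at the point at infinity of the chart `0`. [folklore] -/
theorem field_of_not_coordNeZero {p : ComplexProjectiveSpace 1} (hp : ¬ CoordNeZero 0 p) :
    field ξu ξv p = ξv (coord 1 p) := by
  unfold field; rw [if_neg hp]

/-- On the whole chart `1` the field is `ξv`, given the gluing `ξv w = ξu w⁻¹`. [folklore] -/
theorem field_of_coordNeZero_one (hξuv : ∀ w : ℂ, w ≠ 0 → ξv w = ξu w⁻¹)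
    {p : ComplexProjectiveSpace 1} (hp : CoordNeZero 1 p) : field ξu ξv p = ξv (coord 1 p) := by
  by_cases h0 : CoordNeZero 0 p
  · rw [field_of_coordNeZero h0]
    have h := coord_zero_mul_coord_one h0 hp
    have hw : coord 1 p ≠ 0 := fun hw => by rw [hw, mul_zero] at h; exact zero_ne_one h
    rw [hξuv _ hw]
    congr 1
    exact (eq_inv_of_mul_eq_one_left h)
  · exact field_of_not_coordNeZero h0

/-! ### The chain rule on the overlap: `dv(∂_w) = -z² · du(∂_z)` -/

/-- The real differential of `w ↦ w⁻¹` at `w ≠ 0` applied to `1` is `-(w²)⁻¹`. [folklore] -/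
theorem mfderiv_inv_apply_one {w : ℂ} (hw : w ≠ 0) :
    mfderiv 𝓘(ℝ, ℂ) 𝓘(ℝ, ℂ) (fun z : ℂ => z⁻¹) w (1 : ℂ) = -(w ^ 2)⁻¹ := by
  have h := ((hasDerivAt_inv hw).hasFDerivAt.restrictScalars ℝ)
  rw [mfderiv_eq_fderiv, h.fderiv]
  change ((ContinuousLinearMap.toSpanSingleton ℂ (-(w ^ 2)⁻¹)).restrictScalars ℝ : ℂ →L[ℝ] ℂ) 1 = _
  simp

/-- `w ↦ w⁻¹` is differentiable away from `0`. [folklore] -/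
theorem mdifferentiableAt_inv {w : ℂ} (hw : w ≠ 0) :
    MDifferentiableAt 𝓘(ℝ, ℂ) 𝓘(ℝ, ℂ) (fun z : ℂ => z⁻¹) w := by
  rw [mdifferentiableAt_iff_differentiableAt]
  exact ((hasDerivAt_inv hw).hasFDerivAt.restrictScalars ℝ).differentiableAt

/-- **The chain rule on the overlap**: `dv_w(1) = (-z²) · du_z(1)` for a `J`-holomorphic `u`,
`v = u ∘ (·)⁻¹` near `w ≠ 0` and `z = w⁻¹`. [folklore] -/
theorem mfderiv_v_apply_one (hu : ContMDiff 𝓘(ℝ, ℂ) (𝓡 4) 1 u)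
    (huv : ∀ z : ℂ, z ≠ 0 → v z = u z⁻¹) (hJu : IsJHolomorphic (𝓡 4) (fun y => JX y) u)
    {w z : ℂ} (hw : w ≠ 0) (hz : z = w⁻¹) :
    mfderiv 𝓘(ℝ, ℂ) (𝓡 4) v w (1 : ℂ) =
      jsmul JX (u z) (-z ^ 2) (mfderiv 𝓘(ℝ, ℂ) (𝓡 4) u z (1 : ℂ)) := by
  subst hz
  have hev : v =ᶠ[𝓝 w] (u ∘ fun z : ℂ => z⁻¹) := by
    filter_upwards [isOpen_ne.mem_nhds hw] with z hz
    exact huv z hz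
  rw [hev.mfderiv_eq, mfderiv_comp w (hu.mdifferentiableAt one_ne_zero) (mdifferentiableAt_inv hw)]
  set L : ℂ →L[ℝ] EuclideanSpace ℝ (Fin 4) := mfderiv 𝓘(ℝ, ℂ) (𝓡 4) u w⁻¹ with hL
  set M : ℂ →L[ℝ] ℂ := mfderiv 𝓘(ℝ, ℂ) 𝓘(ℝ, ℂ) (fun z : ℂ => z⁻¹) w with hM
  have hM1 : M 1 = -(w ^ 2)⁻¹ := mfderiv_inv_apply_one hw
  change L (M 1) = jsmul JX (u w⁻¹) (-w⁻¹ ^ 2) (L 1)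
  rw [hM1, show (-(w ^ 2)⁻¹ : ℂ) = -w⁻¹ ^ 2 by rw [inv_pow]]
  exact mfderiv_apply_eq_jsmul JX hJu w⁻¹ _

/-! ### The frames in the fibres of the pulled-back complex tangent bundle -/

/-- The complex tangent bundle pulled back along the glued map `F₀ : ℂℙ¹ → X`. [folklore] -/
abbrev pulled (F₀ : C(ComplexProjectiveSpace 1, X)) : ComplexVectorBundle.{0, 0} (ComplexProjectiveSpace 1) :=
  JX.complexTangentBundle.pullback F₀

/-- The Whitney sum `ℂ̲ ⊕ 𝒪(2)` over `ℂℙ¹`. [folklore] -/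
abbrev split : ComplexVectorBundle.{0, 0} (ComplexProjectiveSpace 1) :=
  (ComplexVectorBundle.trivial (ComplexProjectiveSpace 1) ℂ).directSum bundle

/-- The tangent frame of chart `k` at `p`, in the fibre of the pulled-back complex tangent bundle. [folklore] -/
def frameF (u v : ℂ → X) (F₀ : C(ComplexProjectiveSpace 1, X)) (k : Fin (1 + 1))
    (p : ComplexProjectiveSpace 1) : (pulled JX F₀).E p :=
  (JX.complexTangentCore_fiberEquiv (F₀ p)).symm (frame u v k p)

/-- The transverse field at `p`, in the fibre of the pulled-back complex tangent bundle. [folklore] -/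
def fieldF (ξu ξv : ℂ → EuclideanSpace ℝ (Fin 4)) (F₀ : C(ComplexProjectiveSpace 1, X))
    (p : ComplexProjectiveSpace 1) : (pulled JX F₀).E p :=
  (JX.complexTangentCore_fiberEquiv (F₀ p)).symm (field ξu ξv p)

section Algebra

variable (hu : ContMDiff 𝓘(ℝ, ℂ) (𝓡 4) 1 u) (huv : ∀ z : ℂ, z ≠ 0 → v z = u z⁻¹)
  (hJu : IsJHolomorphic (𝓡 4) (fun y => JX y) u)
  (hF0 : ∀ p, CoordNeZero 0 p → F₀ p = u (affineCoordComplex 0 p 0))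

include hu huv hJu in
/-- On the overlap, `frame 1 = (-z²) · frame 0`. [folklore] -/
theorem frame_one_eq {p : ComplexProjectiveSpace 1} (h0 : CoordNeZero 0 p) (h1 : CoordNeZero 1 p) :
    frame u v 1 p = jsmul JX (u (coord 0 p)) (-(coord 0 p) ^ 2) (frame u v 0 p) := by
  have hzw := coord_zero_mul_coord_one h0 h1
  have hw : coord 1 p ≠ 0 := fun hw => by rw [hw, mul_zero] at hzw; exact zero_ne_one hzw
  have hz : coord 0 p = (coord 1 p)⁻¹ := eq_inv_of_mul_eq_one_left hzw
  rw [frame_one, frame_zero]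
  exact mfderiv_v_apply_one JX hu huv hJu hw hz

include hu huv hJu hF0 in
/-- **The two tangent frames differ by the cocycle of `𝒪(2)`**: on the overlap of the charts,
`frame i = g_{ij} · frame j` with `g_{10} = -z²`. [folklore] -/
theorem frameF_eq_cocycle_smul {i j : Fin (1 + 1)} {p : ComplexProjectiveSpace 1}
    (hi : CoordNeZero i p) (hj : CoordNeZero j p) :
    frameF JX u v F₀ i p = cocycle i j p • frameF JX u v F₀ j p := by
  -- the basic case `(i, j) = (1, 0)`
  have h10 : ∀ {p : ComplexProjectiveSpace 1}, CoordNeZero 0 p → CoordNeZero 1 p →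
      frameF JX u v F₀ 1 p = cocycle 1 0 p • frameF JX u v F₀ 0 p := by
    intro p h0 h1
    unfold frameF
    rw [frame_one_eq JX hu huv hJu h0 h1, cocycle_of_ne (show (1 : Fin (1 + 1)) ≠ 0 by decide)]
    exact fiberEquiv_symm_jsmul' JX (hF0 p h0).symm _ _
  rcases fin_two_eq_zero_or_one i with rfl | rfl <;> rcases fin_two_eq_zero_or_one j with rfl | rfl
  · rw [cocycle_self, one_smul]
  · have key := h10 hi hj
    rw [key, smul_smul, cocycle_comp hj hi hj, cocycle_self, one_smul]
  · exact h10 hj hi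
  · rw [cocycle_self, one_smul]

end Algebra

/-! ### Continuity of the frames and of the field as sections over `ℂℙ¹` of `(TX, J) → X` -/

section Lifts

/-- The tangent lift `z ↦ ⟨u z, du_z(1)⟩` of a `C¹` map is continuous. [folklore] -/
theorem continuous_tangentLift (hu : ContMDiff 𝓘(ℝ, ℂ) (𝓡 4) 1 u) :
    Continuous fun z : ℂ => (⟨u z, mfderiv 𝓘(ℝ, ℂ) (𝓡 4) u z (1 : ℂ)⟩ : TangentBundle (𝓡 4) X) := by
  have h1 : Continuous (tangentMap 𝓘(ℝ, ℂ) (𝓡 4) u) := hu.continuous_tangentMap le_rfl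
  have h2 : Continuous fun z : ℂ => (tangentBundleModelSpaceHomeomorph (H := ℂ) 𝓘(ℝ, ℂ)).symm (z, (1 : ℂ)) :=
    (tangentBundleModelSpaceHomeomorph (H := ℂ) 𝓘(ℝ, ℂ)).symm.continuous.comp
      (continuous_id.prodMk continuous_const)
  exact h1.comp h2

variable (hu : ContMDiff 𝓘(ℝ, ℂ) (𝓡 4) 1 u) (hv : ContMDiff 𝓘(ℝ, ℂ) (𝓡 4) 1 v)
  (hF0 : ∀ p, CoordNeZero 0 p → F₀ p = u (affineCoordComplex 0 p 0))
  (hF1 : ∀ p, CoordNeZero 1 p → F₀ p = v (affineCoordComplex 1 p 0))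
  (hξu : Continuous fun z : ℂ => (⟨u z, ξu z⟩ : TangentBundle (𝓡 4) X))
  (hξv : Continuous fun w : ℂ => (⟨v w, ξv w⟩ : TangentBundle (𝓡 4) X))
  (hξuv : ∀ w : ℂ, w ≠ 0 → ξv w = ξu w⁻¹)

include hu hF0 in
/-- The frame of the chart `0` is a continuous section along `F₀` on the chart `0`. [folklore] -/
theorem continuousAt_frameLift_zero {p₀ : ComplexProjectiveSpace 1} (h0 : CoordNeZero 0 p₀) :
    ContinuousAt (fun p => (⟨F₀ p, frameF JX u v F₀ 0 p⟩ : JX.complexTangentCore.TotalSpace)) p₀ := by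
  have key : ∀ p, (⟨F₀ p, frameF JX u v F₀ 0 p⟩ : JX.complexTangentCore.TotalSpace) =
      JX.tangentHomeomorph.symm ⟨F₀ p, frame u v 0 p⟩ := fun p =>
    (tangentHomeomorph_symm_apply JX _ _).symm
  simp_rw [key]
  refine JX.tangentHomeomorph.symm.continuous.continuousAt.comp ?_
  have hev : (fun p => (⟨F₀ p, frame u v 0 p⟩ : TangentBundle (𝓡 4) X)) =ᶠ[𝓝 p₀]
      fun p => ⟨u (coord 0 p), mfderiv 𝓘(ℝ, ℂ) (𝓡 4) u (coord 0 p) (1 : ℂ)⟩ := by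
    filter_upwards [(isOpen_setOf_coordNeZero (n := 1) 0).mem_nhds h0] with p hp
    rw [frame_zero, hF0 p hp]
  refine ContinuousAt.congr_of_eventuallyEq ?_ hev
  exact (continuous_tangentLift hu).continuousAt.comp
    ((continuousOn_coord 0).continuousAt ((isOpen_setOf_coordNeZero (n := 1) 0).mem_nhds h0))

include hv hF1 in
/-- The frame of the chart `1` is a continuous section along `F₀` on the chart `1`. [folklore] -/
theorem continuousAt_frameLift_one {p₀ : ComplexProjectiveSpace 1} (h1 : CoordNeZero 1 p₀) :
    ContinuousAt (fun p => (⟨F₀ p, frameF JX u v F₀ 1 p⟩ : JX.complexTangentCore.TotalSpace)) p₀ := by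
  have key : ∀ p, (⟨F₀ p, frameF JX u v F₀ 1 p⟩ : JX.complexTangentCore.TotalSpace) =
      JX.tangentHomeomorph.symm ⟨F₀ p, frame u v 1 p⟩ := fun p =>
    (tangentHomeomorph_symm_apply JX _ _).symm
  simp_rw [key]
  refine JX.tangentHomeomorph.symm.continuous.continuousAt.comp ?_
  have hev : (fun p => (⟨F₀ p, frame u v 1 p⟩ : TangentBundle (𝓡 4) X)) =ᶠ[𝓝 p₀]
      fun p => ⟨v (coord 1 p), mfderiv 𝓘(ℝ, ℂ) (𝓡 4) v (coord 1 p) (1 : ℂ)⟩ := by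
    filter_upwards [(isOpen_setOf_coordNeZero (n := 1) 1).mem_nhds h1] with p hp
    rw [frame_one, hF1 p hp]
  refine ContinuousAt.congr_of_eventuallyEq ?_ hev
  exact (continuous_tangentLift hv).continuousAt.comp
    ((continuousOn_coord 1).continuousAt ((isOpen_setOf_coordNeZero (n := 1) 1).mem_nhds h1))

include hu hv hF0 hF1 in
/-- The frame of the chart `k` is a continuous section along `F₀` on the chart `k`. [folklore] -/
theorem continuousAt_frameLift {k : Fin (1 + 1)} {p₀ : ComplexProjectiveSpace 1} (hk : CoordNeZero k p₀) :
    ContinuousAt (fun p => (⟨F₀ p, frameF JX u v F₀ k p⟩ : JX.complexTangentCore.TotalSpace)) p₀ := by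
  rcases fin_two_eq_zero_or_one k with rfl | rfl
  · exact continuousAt_frameLift_zero JX hu hF0 hk
  · exact continuousAt_frameLift_one JX hv hF1 hk

include hF0 hF1 hξu hξv hξuv in
/-- The field is a continuous section along `F₀`. [folklore] -/
theorem continuous_fieldLift :
    Continuous (fun p => (⟨F₀ p, fieldF JX ξu ξv F₀ p⟩ : JX.complexTangentCore.TotalSpace)) := by
  have key : ∀ p, (⟨F₀ p, fieldF JX ξu ξv F₀ p⟩ : JX.complexTangentCore.TotalSpace) =
      JX.tangentHomeomorph.symm ⟨F₀ p, field ξu ξv p⟩ := fun p =>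
    (tangentHomeomorph_symm_apply JX _ _).symm
  simp_rw [key]
  refine JX.tangentHomeomorph.symm.continuous.comp ?_
  rw [continuous_iff_continuousAt]
  intro p₀
  by_cases h0 : CoordNeZero 0 p₀
  · have hev : (fun p => (⟨F₀ p, field ξu ξv p⟩ : TangentBundle (𝓡 4) X)) =ᶠ[𝓝 p₀]
        fun p => ⟨u (coord 0 p), ξu (coord 0 p)⟩ := by
      filter_upwards [(isOpen_setOf_coordNeZero (n := 1) 0).mem_nhds h0] with p hp
      rw [field_of_coordNeZero hp, hF0 p hp]
    refine ContinuousAt.congr_of_eventuallyEq ?_ hev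
    exact hξu.continuousAt.comp
      ((continuousOn_coord 0).continuousAt ((isOpen_setOf_coordNeZero (n := 1) 0).mem_nhds h0))
  · have h1 : CoordNeZero 1 p₀ := coordNeZero_one_of_not_coordNeZero_zero h0
    have hev : (fun p => (⟨F₀ p, field ξu ξv p⟩ : TangentBundle (𝓡 4) X)) =ᶠ[𝓝 p₀]
        fun p => ⟨v (coord 1 p), ξv (coord 1 p)⟩ := by
      filter_upwards [(isOpen_setOf_coordNeZero (n := 1) 1).mem_nhds h1] with p hp
      rw [field_of_coordNeZero_one hξuv hp, hF1 p hp]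
    refine ContinuousAt.congr_of_eventuallyEq ?_ hev
    exact hξv.continuousAt.comp
      ((continuousOn_coord 1).continuousAt ((isOpen_setOf_coordNeZero (n := 1) 1).mem_nhds h1))

/-- A section along `F₀`, continuous at `p₀`, read in the trivialisation of `(TX, J)` at `F₀ p₀`,
has continuous coordinate there. [folklore] -/
theorem continuousAt_read {σ : ∀ p : ComplexProjectiveSpace 1, JX.complexTangentCore.Fiber (F₀ p)}
    {p₀ : ComplexProjectiveSpace 1}
    (hσ : ContinuousAt (fun p => (⟨F₀ p, σ p⟩ : JX.complexTangentCore.TotalSpace)) p₀) :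
    ContinuousAt (fun p => ((JX.complexTangentCore.localTriv (F₀ p₀)) ⟨F₀ p, σ p⟩).2) p₀ := by
  set e := JX.complexTangentCore.localTriv (F₀ p₀) with he
  have h1 : ContinuousAt e ⟨F₀ p₀, σ p₀⟩ :=
    e.continuousAt (e.mem_source.2 (JX.complexTangentCore.mem_baseSet_at (F₀ p₀)))
  exact (ContinuousAt.comp (f := fun p => (⟨F₀ p, σ p⟩ : JX.complexTangentCore.TotalSpace)) h1 hσ).snd

end Lifts

/-! ### The fibrewise splitting map and its bijectivity -/

section Fibre

/-- The `ℂ̲`-coefficient of a vector of `ℂ̲ ⊕ 𝒪(2)`. [folklore] -/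
def coefT {p : ComplexProjectiveSpace 1} (ac : split.E p) : ℂ := ac.1

/-- The `𝒪(2)`-coefficient (in the distinguished chart at `p`) of a vector of `ℂ̲ ⊕ 𝒪(2)`. [folklore] -/
def coefL {p : ComplexProjectiveSpace 1} (ac : split.E p) : ℂ := ac.2

/-- `coefT` is additive. [folklore] -/
theorem coefT_add {p : ComplexProjectiveSpace 1} (ac ac' : split.E p) : coefT (ac + ac') = coefT ac + coefT ac' := rfl

/-- `coefL` is additive. [folklore] -/
theorem coefL_add {p : ComplexProjectiveSpace 1} (ac ac' : split.E p) : coefL (ac + ac') = coefL ac + coefL ac' := rfl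

/-- `coefT` is homogeneous. [folklore] -/
theorem coefT_smul {p : ComplexProjectiveSpace 1} (c : ℂ) (ac : split.E p) : coefT (c • ac) = c * coefT ac := rfl

/-- `coefL` is homogeneous. [folklore] -/
theorem coefL_smul {p : ComplexProjectiveSpace 1} (c : ℂ) (ac : split.E p) : coefL (c • ac) = c * coefL ac := rfl

/-- A vector of `ℂ̲ ⊕ 𝒪(2)` with zero coefficients is zero. [folklore] -/
theorem eq_zero_of_coef {p : ComplexProjectiveSpace 1} {ac : split.E p} (h1 : coefT ac = 0) (h2 : coefL ac = 0) :
    ac = 0 := Prod.ext h1 h2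

/-- **The splitting map on the fibre over `p`**: `(a, ℓ) ↦ a · ξ̂(p) + ℓ · frame_{k(p)}(p)`
(`k(p)` the distinguished chart of `𝒪(2)` at `p`). [folklore] -/
def fibreMap (u v : ℂ → X) (ξu ξv : ℂ → EuclideanSpace ℝ (Fin 4)) (F₀ : C(ComplexProjectiveSpace 1, X))
    (p : ComplexProjectiveSpace 1) : split.E p →ₗ[ℂ] (pulled JX F₀).E p where
  toFun ac := coefT ac • fieldF JX ξu ξv F₀ p + coefL ac • frameF JX u v F₀ (core.indexAt p) p
  map_add' ac ac' := by
    rw [coefT_add, coefL_add, add_smul, add_smul]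
    abel
  map_smul' c ac := by
    rw [coefT_smul, coefL_smul, RingHom.id_apply, smul_add, mul_smul, mul_smul]

/-- Unfolding `fibreMap`. [folklore] -/
theorem fibreMap_apply (p : ComplexProjectiveSpace 1) (ac : split.E p) :
    fibreMap JX u v ξu ξv F₀ p ac =
      coefT ac • fieldF JX ξu ξv F₀ p + coefL ac • frameF JX u v F₀ (core.indexAt p) p := rfl

variable (hF0 : ∀ p, CoordNeZero 0 p → F₀ p = u (affineCoordComplex 0 p 0))
  (hF1 : ∀ p, CoordNeZero 1 p → F₀ p = v (affineCoordComplex 1 p 0))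
  (hindu : ∀ (z : ℂ) (s t : ℂ), jsmul JX (u z) s (ξu z) +
    jsmul JX (u z) t (mfderiv 𝓘(ℝ, ℂ) (𝓡 4) u z (1 : ℂ)) = 0 → s = 0 ∧ t = 0)
  (hindv : ∀ (w : ℂ) (s t : ℂ), jsmul JX (v w) s (ξv w) +
    jsmul JX (v w) t (mfderiv 𝓘(ℝ, ℂ) (𝓡 4) v w (1 : ℂ)) = 0 → s = 0 ∧ t = 0)

/-- Transport of the independence hypothesis along an equality of base points. [folklore] -/
theorem indep_transport {x y : X} (h : x = y) {ξ η : TangentSpace (𝓡 4) x}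
    (hind : ∀ s t : ℂ, jsmul JX x s ξ + jsmul JX x t η = 0 → s = 0 ∧ t = 0) (s t : ℂ)
    (hst : s • (JX.complexTangentCore_fiberEquiv y).symm ξ + t • (JX.complexTangentCore_fiberEquiv y).symm η = 0) :
    s = 0 ∧ t = 0 := by
  subst h
  apply hind s t
  have h1 := congrArg (JX.complexTangentCore_fiberEquiv x) hst
  rw [map_add, map_zero, ← fiberEquiv_symm_jsmul, ← fiberEquiv_symm_jsmul,
    ContinuousLinearEquiv.apply_symm_apply, ContinuousLinearEquiv.apply_symm_apply] at h1
  exact h1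

include hF0 hF1 hindu hindv in
/-- **The field and the distinguished frame are `ℂ`-independent in every fibre.** [folklore] -/
theorem fibre_indep (p : ComplexProjectiveSpace 1) (s t : ℂ)
    (hst : s • fieldF JX ξu ξv F₀ p + t • frameF JX u v F₀ (core.indexAt p) p = 0) : s = 0 ∧ t = 0 := by
  by_cases h0 : CoordNeZero 0 p
  · rw [core_indexAt_of_coordNeZero h0] at hst
    unfold fieldF frameF at hst
    rw [field_of_coordNeZero h0, frame_zero] at hst
    exact indep_transport JX (hF0 p h0).symm (hindu (coord 0 p)) s t hst
  · have h1 : CoordNeZero 1 p := coordNeZero_one_of_not_coordNeZero_zero h0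
    rw [core_indexAt_of_not_coordNeZero h0] at hst
    unfold fieldF frameF at hst
    rw [field_of_not_coordNeZero h0, frame_one] at hst
    exact indep_transport JX (hF1 p h1).symm (hindv (coord 1 p)) s t hst

include hF0 hF1 hindu hindv in
/-- The splitting map is injective on every fibre. [folklore] -/
theorem fibreMap_injective (p : ComplexProjectiveSpace 1) : Injective (fibreMap JX u v ξu ξv F₀ p) := by
  refine (injective_iff_map_eq_zero _).2 fun ac hac => ?_
  obtain ⟨h1, h2⟩ := fibre_indep JX hF0 hF1 hindu hindv p _ _ hac
  exact eq_zero_of_coef h1 h2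

/-- `dim_ℂ (ℂ × ℂ) = 2`. [folklore] -/
theorem finrank_split_F : Module.finrank ℂ split.F = 2 := by
  change Module.finrank ℂ (ℂ × ℂ) = 2
  rw [Module.finrank_prod, Module.finrank_self]

/-- `dim_ℂ` of the model fibre of `(TX, J)` is `2` for `dim X = 4`. [folklore] -/
theorem finrank_pulled_F (F₀ : C(ComplexProjectiveSpace 1, X)) : Module.finrank ℂ (pulled JX F₀).F = 2 := by
  change Module.finrank ℂ (Fin (Module.finrank ℝ (EuclideanSpace ℝ (Fin 4)) / 2) → ℂ) = 2
  rw [Module.finrank_fin_fun, finrank_euclideanSpace_fin]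

/-- The trivialisation of `ℂ̲ ⊕ 𝒪(2)` at `p`, on the fibre over `p`. [folklore] -/
def T1 (p : ComplexProjectiveSpace 1) : split.E p ≃L[ℂ] split.F :=
  (trivializationAt split.F split.E p).continuousLinearEquivAt ℂ p (mem_baseSet_trivializationAt _ _ p)

/-- The trivialisation of the pulled-back complex tangent bundle at `p`, on the fibre over `p`. [folklore] -/
def T2 (F₀ : C(ComplexProjectiveSpace 1, X)) (p : ComplexProjectiveSpace 1) :
    (pulled JX F₀).E p ≃L[ℂ] (pulled JX F₀).F :=
  (trivializationAt (pulled JX F₀).F (pulled JX F₀).E p).continuousLinearEquivAt ℂ p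
    (mem_baseSet_trivializationAt _ _ p)

/-- The splitting map read on the model fibres. [folklore] -/
def modelMap (u v : ℂ → X) (ξu ξv : ℂ → EuclideanSpace ℝ (Fin 4)) (F₀ : C(ComplexProjectiveSpace 1, X))
    (p : ComplexProjectiveSpace 1) : split.F →ₗ[ℂ] (pulled JX F₀).F :=
  (T2 JX F₀ p).toLinearEquiv.toLinearMap ∘ₗ (fibreMap JX u v ξu ξv F₀ p ∘ₗ (T1 p).symm.toLinearEquiv.toLinearMap)

include hF0 hF1 hindu hindv in
/-- The model splitting map is bijective (injective, equal dimensions). [folklore] -/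
theorem modelMap_bijective (p : ComplexProjectiveSpace 1) : Bijective (modelMap JX u v ξu ξv F₀ p) := by
  have hinj : Injective (modelMap JX u v ξu ξv F₀ p) :=
    (T2 JX F₀ p).injective.comp ((fibreMap_injective JX hF0 hF1 hindu hindv p).comp (T1 p).symm.injective)
  refine ⟨hinj, ?_⟩
  exact (LinearMap.injective_iff_surjective_of_finrank_eq_finrank
    (by rw [finrank_split_F, finrank_pulled_F])).1 hinj

/-- **The splitting isomorphism on the fibre over `p`.** [folklore] -/
def fibreEquiv (hF0 : ∀ p, CoordNeZero 0 p → F₀ p = u (affineCoordComplex 0 p 0))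
    (hF1 : ∀ p, CoordNeZero 1 p → F₀ p = v (affineCoordComplex 1 p 0))
    (hindu : ∀ (z : ℂ) (s t : ℂ), jsmul JX (u z) s (ξu z) +
      jsmul JX (u z) t (mfderiv 𝓘(ℝ, ℂ) (𝓡 4) u z (1 : ℂ)) = 0 → s = 0 ∧ t = 0)
    (hindv : ∀ (w : ℂ) (s t : ℂ), jsmul JX (v w) s (ξv w) +
      jsmul JX (v w) t (mfderiv 𝓘(ℝ, ℂ) (𝓡 4) v w (1 : ℂ)) = 0 → s = 0 ∧ t = 0)
    (p : ComplexProjectiveSpace 1) : split.E p ≃L[ℂ] (pulled JX F₀).E p :=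
  (T1 p).trans
    (((LinearEquiv.ofBijective (modelMap JX u v ξu ξv F₀ p)
      (modelMap_bijective JX hF0 hF1 hindu hindv p)).toContinuousLinearEquiv).trans (T2 JX F₀ p).symm)

/-- The splitting isomorphism is the splitting map on each fibre. [folklore] -/
theorem fibreEquiv_apply (p : ComplexProjectiveSpace 1) (ac : split.E p) :
    fibreEquiv JX hF0 hF1 hindu hindv p ac = fibreMap JX u v ξu ξv F₀ p ac := by
  change (T2 JX F₀ p).symm (modelMap JX u v ξu ξv F₀ p (T1 p ac)) = _
  simp [modelMap]

end Fibre

/-! ### The splitting isomorphism `ℂ̲ ⊕ 𝒪(2) ≅ F₀^*(TX, J)` -/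

section Iso

variable (hu : ContMDiff 𝓘(ℝ, ℂ) (𝓡 4) 1 u) (hv : ContMDiff 𝓘(ℝ, ℂ) (𝓡 4) 1 v)
  (huv : ∀ z : ℂ, z ≠ 0 → v z = u z⁻¹) (hJu : IsJHolomorphic (𝓡 4) (fun y => JX y) u)
  (hF0 : ∀ p, CoordNeZero 0 p → F₀ p = u (affineCoordComplex 0 p 0))
  (hF1 : ∀ p, CoordNeZero 1 p → F₀ p = v (affineCoordComplex 1 p 0))
  (hξu : Continuous fun z : ℂ => (⟨u z, ξu z⟩ : TangentBundle (𝓡 4) X))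
  (hξv : Continuous fun w : ℂ => (⟨v w, ξv w⟩ : TangentBundle (𝓡 4) X))
  (hξuv : ∀ w : ℂ, w ≠ 0 → ξv w = ξu w⁻¹)
  (hindu : ∀ (z : ℂ) (s t : ℂ), jsmul JX (u z) s (ξu z) +
    jsmul JX (u z) t (mfderiv 𝓘(ℝ, ℂ) (𝓡 4) u z (1 : ℂ)) = 0 → s = 0 ∧ t = 0)
  (hindv : ∀ (w : ℂ) (s t : ℂ), jsmul JX (v w) s (ξv w) +
    jsmul JX (v w) t (mfderiv 𝓘(ℝ, ℂ) (𝓡 4) v w (1 : ℂ)) = 0 → s = 0 ∧ t = 0)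

/-- The lift of the `𝒪(2)`-component of a point of `ℂ̲ ⊕ 𝒪(2)` is continuous. [folklore] -/
theorem continuous_coreLift :
    Continuous fun q : TotalSpace split.F split.E => (⟨q.proj, q.2.2⟩ : TotalSpace ℂ core.Fiber) :=
  continuous_snd.comp (FiberBundle.Prod.isInducing_diag ℂ (Bundle.Trivial (ComplexProjectiveSpace 1) ℂ)
    ℂ core.Fiber).continuous

/-- The `ℂ̲`-coefficient of a point of `ℂ̲ ⊕ 𝒪(2)` is continuous. [folklore] -/
theorem continuous_coef_fst : Continuous fun q : TotalSpace split.F split.E => coefT q.2 := by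
  have h1 : Continuous fun q : TotalSpace split.F split.E =>
      (⟨q.proj, q.2.1⟩ : TotalSpace ℂ (Bundle.Trivial (ComplexProjectiveSpace 1) ℂ)) :=
    continuous_fst.comp (FiberBundle.Prod.isInducing_diag ℂ (Bundle.Trivial (ComplexProjectiveSpace 1) ℂ)
      ℂ core.Fiber).continuous
  have h2 : Continuous fun x : TotalSpace ℂ (Bundle.Trivial (ComplexProjectiveSpace 1) ℂ) => x.2 :=
    continuous_snd.comp (Bundle.Trivial.homeomorphProd (ComplexProjectiveSpace 1) ℂ).continuous
  exact h2.comp h1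

/-- The `𝒪(2)`-coefficient read in the chart `k₀` is continuous near a point of that chart. [folklore] -/
theorem continuousAt_coef_snd {q₀ : TotalSpace split.F split.E} {k₀ : Fin (1 + 1)}
    (hk : CoordNeZero k₀ q₀.proj) :
    ContinuousAt (fun q : TotalSpace split.F split.E => ((core.localTriv k₀) ⟨q.proj, q.2.2⟩).2) q₀ := by
  have h1 : ContinuousAt (core.localTriv k₀) ⟨q₀.proj, q₀.2.2⟩ :=
    (core.localTriv k₀).continuousAt ((core.localTriv k₀).mem_source.2 hk)
  exact (ContinuousAt.comp (f := fun q : TotalSpace split.F split.E => (⟨q.proj, q.2.2⟩ : TotalSpace ℂ core.Fiber))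
    h1 continuous_coreLift.continuousAt).snd

include hu hv huv hJu hξu hξv hξuv in
/-- **The splitting map of total spaces `ℂ̲ ⊕ 𝒪(2) → F₀^*(TX, J)` is continuous**: near a point
over `p₀`, in the distinguished chart `k₀` of `𝒪(2)` at `p₀` and the trivialisation of `(TX, J)`
at `F₀ p₀`, it is `(q, a, ℓ) ↦ a · ξ̂(q) + ℓ · frame_{k₀}(q)` read in the trivialisation — a
linear combination, with continuous coefficients, of two continuous sections. [folklore] -/
theorem continuous_forward :
    Continuous fun q : TotalSpace split.F split.E =>
      (⟨q.proj, fibreEquiv JX hF0 hF1 hindu hindv q.proj q.2⟩ :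
        TotalSpace (pulled JX F₀).F (pulled JX F₀).E) := by
  refine (inducing_pullbackTotalSpaceEmbedding (Fin (Module.finrank ℝ (EuclideanSpace ℝ (Fin 4)) / 2) → ℂ)
    JX.complexTangentCore.Fiber F₀).continuous_iff.2 ?_
  refine (FiberBundle.continuous_proj split.F split.E).prodMk ?_
  change Continuous fun q : TotalSpace split.F split.E =>
    (⟨F₀ q.proj, fibreEquiv JX hF0 hF1 hindu hindv q.proj q.2⟩ : JX.complexTangentCore.TotalSpace)
  rw [continuous_iff_continuousAt]
  intro q₀
  have hk₀ : CoordNeZero (core.indexAt q₀.proj) q₀.proj := core.mem_baseSet_at q₀.proj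
  rw [FiberBundle.continuousAt_totalSpace]
  refine ⟨(F₀.continuous.comp (FiberBundle.continuous_proj split.F split.E)).continuousAt, ?_⟩
  change ContinuousAt (fun q : TotalSpace split.F split.E =>
    ((JX.complexTangentCore.localTriv (F₀ q₀.proj))
      ⟨F₀ q.proj, fibreEquiv JX hF0 hF1 hindu hindv q.proj q.2⟩).2) q₀
  -- the continuous ingredients
  have hproj : ContinuousAt (fun q : TotalSpace split.F split.E => q.proj) q₀ :=
    (FiberBundle.continuous_proj split.F split.E).continuousAt
  have hRξ : ContinuousAt (fun q : TotalSpace split.F split.E =>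
      ((JX.complexTangentCore.localTriv (F₀ q₀.proj)) ⟨F₀ q.proj, fieldF JX ξu ξv F₀ q.proj⟩).2) q₀ :=
    ContinuousAt.comp (f := fun q : TotalSpace split.F split.E => q.proj)
      (continuousAt_read JX (continuous_fieldLift JX hF0 hF1 hξu hξv hξuv).continuousAt) hproj
  have hRη : ContinuousAt (fun q : TotalSpace split.F split.E =>
      ((JX.complexTangentCore.localTriv (F₀ q₀.proj))
        ⟨F₀ q.proj, frameF JX u v F₀ (core.indexAt q₀.proj) q.proj⟩).2) q₀ :=
    ContinuousAt.comp (f := fun q : TotalSpace split.F split.E => q.proj)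
      (continuousAt_read JX (continuousAt_frameLift JX hu hv hF0 hF1 hk₀)) hproj
  have ha := (continuous_coef_fst).continuousAt (x := q₀)
  have hc := continuousAt_coef_snd (q₀ := q₀) hk₀
  have key := (ha.smul hRξ).add (hc.smul hRη)
  refine key.congr_of_eventuallyEq ?_
  have hopen : IsOpen {q : TotalSpace split.F split.E | CoordNeZero (core.indexAt q₀.proj) q.proj} :=
    (isOpen_setOf_coordNeZero (core.indexAt q₀.proj)).preimage (FiberBundle.continuous_proj split.F split.E)
  filter_upwards [hopen.mem_nhds hk₀] with q hq
  simp only [Pi.add_apply, Pi.smul_apply']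
  rw [fibreEquiv_apply, fibreMap_apply,
    frameF_eq_cocycle_smul JX hu huv hJu hF0 (core.mem_baseSet_at q.proj) hq]
  simp only [VectorBundleCore.localTriv_apply, smul_smul, core_coordChange_apply]
  set C := JX.complexTangentCore.coordChange (JX.complexTangentCore.indexAt (F₀ q.proj)) (F₀ q₀.proj) (F₀ q.proj)
    with hC
  have e1 : C (coefT q.2 • fieldF JX ξu ξv F₀ q.proj +
      (coefL q.2 * cocycle (core.indexAt q.proj) (core.indexAt q₀.proj) q.proj) •
        frameF JX u v F₀ (core.indexAt q₀.proj) q.proj) =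
      C (coefT q.2 • fieldF JX ξu ξv F₀ q.proj) +
      C ((coefL q.2 * cocycle (core.indexAt q.proj) (core.indexAt q₀.proj) q.proj) •
        frameF JX u v F₀ (core.indexAt q₀.proj) q.proj) := C.map_add _ _
  have e2 : C (coefT q.2 • fieldF JX ξu ξv F₀ q.proj) = coefT q.2 • C (fieldF JX ξu ξv F₀ q.proj) :=
    C.map_smul _ _
  have e3 : C ((coefL q.2 * cocycle (core.indexAt q.proj) (core.indexAt q₀.proj) q.proj) •
        frameF JX u v F₀ (core.indexAt q₀.proj) q.proj) =
      (coefL q.2 * cocycle (core.indexAt q.proj) (core.indexAt q₀.proj) q.proj) •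
        C (frameF JX u v F₀ (core.indexAt q₀.proj) q.proj) := C.map_smul _ _
  rw [e1, e2, e3, mul_comm (coefL q.2)]
  rfl

/-- **The splitting isomorphism `ℂ̲ ⊕ 𝒪(2) ≅ F₀^*(TX, J)` of complex vector bundles over `ℂℙ¹`**
(forward continuity `continuous_forward`; backward continuity by Husemoller's criterion
`continuous_totalSpace_symm`). [cite: HusemollerFibreBundles1994, Ch. 3 Thm. 2.5] -/
def splitIso : split.Iso (pulled JX F₀) where
  equiv := fibreEquiv JX hF0 hF1 hindu hindv
  continuous_toFun := continuous_forward JX hu hv huv hJu hF0 hF1 hξu hξv hξuv hindu hindv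
  continuous_invFun := by
    haveI : CompleteSpace split.F := FiniteDimensional.complete ℂ _
    exact continuous_totalSpace_symm (fibreEquiv JX hF0 hF1 hindu hindv)
      (continuous_forward JX hu hv huv hJu hF0 hF1 hξu hξv hξuv hindu hindv)

include hu hv huv hJu hF0 hF1 hξu hξv hξuv hindu hindv in
/-- **`c₁(F₀^*(TX, J)) = c₁(𝒪(2))`** ((C₁) for the splitting isomorphism, the Whitney sum formula in
degree one and `c₁(ℂ̲) = 0`). [cite: HusemollerFibreBundles1994, Ch. 17 §3 (C₁)–(C₂)] -/
theorem chernClassZ_pulled_eq : chernClassZ (pulled JX F₀) 1 = chernClassZ bundle 1 := by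
  have h1 := theChernClassTheory.chernClass_congr
    (splitIso JX hu hv huv hJu hF0 hF1 hξu hξv hξuv hindu hindv) 1
  have h2 := theChernClassTheory.chernClass_one_directSum
    (ComplexVectorBundle.trivial (ComplexProjectiveSpace 1) ℂ) bundle
  have h3 := theChernClassTheory.chernClass_trivial (B := ComplexProjectiveSpace 1) ℂ (i := 1) one_pos
  change chernClassZ split 1 = chernClassZ (pulled JX F₀) 1 at h1
  change chernClassZ split 1 = chernClassZ (ComplexVectorBundle.trivial (ComplexProjectiveSpace 1) ℂ) 1 +
    chernClassZ bundle 1 at h2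
  change chernClassZ (ComplexVectorBundle.trivial (ComplexProjectiveSpace 1) ℂ) 1 = 0 at h3
  rw [← h1, h2, h3, zero_add]

end Iso

/-! ### The glued map is not null-homotopic -/

/-- **An immersed `J`-holomorphic two-chart sphere carrying a transverse field is not
null-homotopic.** Let `(u, v)` be a `C¹` two-chart sphere (`v z = u z⁻¹`) in the almost complex
4-manifold `(X, JX)` with `u` `JX`-holomorphic, glued map `F₀ : ℂℙ¹ → X`, and let `ξu`, `ξv` be
continuous tangent vector fields along `u`, `v`, glued by `ξv w = ξu w⁻¹`, such that at every
parameter the field and the tangent vector `du(1)` (resp. `dv(1)`) are `JX`-complex independent.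
Then `F₀` is not homotopic to a constant map: `F₀^*(TX, J) ≅ ℂ̲ ⊕ 𝒪(2)` has
`c₁ = c₁(𝒪(2)) ≠ 0`, while a null-homotopic map pulls back `c₁(TX, J)` to `0`. (This is the
`c₁`-part of the printed argument: `c₁([S]) = χ(S²) + S · S = 2` for an embedded `J`-sphere with
trivial normal bundle, Wendl 2018, proof of Prop. 2.53 with the adjunction formula (2.5)/Thm. 2.51;
McDuff–Salamon 2017, Thm. 2.7.1.) [cite: Wendl2018, Prop. 2.53 (proof)] [cite: McDuffSalamon2017, Thm. 2.7.1] -/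
theorem not_homotopic_const [T2Space X] [SecondCountableTopology X]
    (hu : ContMDiff 𝓘(ℝ, ℂ) (𝓡 4) 1 u) (hv : ContMDiff 𝓘(ℝ, ℂ) (𝓡 4) 1 v)
    (huv : ∀ z : ℂ, z ≠ 0 → v z = u z⁻¹) (hJu : IsJHolomorphic (𝓡 4) (fun y => JX y) u)
    (hF0 : ∀ p, CoordNeZero 0 p → F₀ p = u (affineCoordComplex 0 p 0))
    (hF1 : ∀ p, CoordNeZero 1 p → F₀ p = v (affineCoordComplex 1 p 0))
    (hξu : Continuous fun z : ℂ => (⟨u z, ξu z⟩ : TangentBundle (𝓡 4) X))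
    (hξv : Continuous fun w : ℂ => (⟨v w, ξv w⟩ : TangentBundle (𝓡 4) X))
    (hξuv : ∀ w : ℂ, w ≠ 0 → ξv w = ξu w⁻¹)
    (hindu : ∀ (z : ℂ) (s t : ℂ), jsmul JX (u z) s (ξu z) +
      jsmul JX (u z) t (mfderiv 𝓘(ℝ, ℂ) (𝓡 4) u z (1 : ℂ)) = 0 → s = 0 ∧ t = 0)
    (hindv : ∀ (w : ℂ) (s t : ℂ), jsmul JX (v w) s (ξv w) +
      jsmul JX (v w) t (mfderiv 𝓘(ℝ, ℂ) (𝓡 4) v w (1 : ℂ)) = 0 → s = 0 ∧ t = 0)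
    (x₀ : X) : ¬ F₀.Homotopic (ContinuousMap.const (ComplexProjectiveSpace 1) x₀) := by
  intro hhom
  haveI : LocallyCompactSpace X := ChartedSpace.locallyCompactSpace (EuclideanSpace ℝ (Fin 4)) X
  have hnat := theChernClassTheory.chernClass_pullback F₀ JX.complexTangentBundle 1
  change chernClassZ (pulled JX F₀) 1 =
    singularCohomology.map ℤ ℤ F₀ (2 * 1) (chernClassZ JX.complexTangentBundle 1) at hnat
  rw [singularCohomology.map_eq_of_homotopic' ℤ ℤ hhom,
    singularCohomology.map_const_eq_zero ℤ ℤ x₀ (by norm_num),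
    chernClassZ_pulled_eq JX hu hv huv hJu hF0 hF1 hξu hξv hξuv hindu hindv] at hnat
  exact chernClassZ_one_bundle_ne_zero hnat

/-! ### The hypotheses from a smooth family of `J`-spheres (the conclusion of the HLS fact) -/

section Family

/-- `J`-complex scalars act: `(c d) · w = c · (d · w)` (uses `J² = -1`). [folklore] -/
theorem jsmul_mul (x : X) (c d : ℂ) (w : TangentSpace (𝓡 4) x) :
    jsmul JX x (c * d) w = jsmul JX x c (jsmul JX x d w) := by
  simp only [jsmul_apply, map_add, map_smul, JX.map_map, Complex.mul_re, Complex.mul_im, smul_add, smul_neg,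
    smul_smul]
  module

/-- `0 · w = 0`. [folklore] -/
theorem jsmul_zero_left (x : X) (w : TangentSpace (𝓡 4) x) : jsmul JX x 0 w = 0 := by
  simp [jsmul_apply]

/-- **Independence of the transverse direction and the tangent direction of a two-parameter map
with injective differential** whose slice `ζ ↦ Φ (0, ζ)` is `J`-holomorphic: if
`s · ∂₁Φ + t · ∂₂Φ = 0` with `J`-complex scalars `s, t`, then `s = t = 0` (the complex line
spanned by `∂₂Φ` is `dΦ({0} × ℂ)`, which misses `∂₁Φ = dΦ(1, 0)`). [folklore] -/
theorem indep_of_injective_mfderiv {Φ : ℂ × ℂ → X} {z : ℂ}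
    (hinj : Injective (mfderiv 𝓘(ℝ, ℂ × ℂ) (𝓡 4) Φ (0, z)))
    (hJ : IsJHolomorphic (𝓡 4) (fun y => JX y) (fun ζ : ℂ => Φ (0, ζ)))
    (hslice : ∀ ζ : ℂ, mfderiv 𝓘(ℝ, ℂ) (𝓡 4) (fun ζ : ℂ => Φ (0, ζ)) z ζ =
      mfderiv 𝓘(ℝ, ℂ × ℂ) (𝓡 4) Φ (0, z) ((0 : ℂ), ζ))
    (s t : ℂ)
    (h : jsmul JX (Φ (0, z)) s (mfderiv 𝓘(ℝ, ℂ × ℂ) (𝓡 4) Φ (0, z) ((1 : ℂ), (0 : ℂ))) +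
      jsmul JX (Φ (0, z)) t (mfderiv 𝓘(ℝ, ℂ) (𝓡 4) (fun ζ : ℂ => Φ (0, ζ)) z (1 : ℂ)) = 0) :
    s = 0 ∧ t = 0 := by
  set D : ℂ × ℂ →L[ℝ] EuclideanSpace ℝ (Fin 4) := mfderiv 𝓘(ℝ, ℂ × ℂ) (𝓡 4) Φ (0, z) with hD
  have hDζ : ∀ c : ℂ, jsmul JX (Φ (0, z)) c (mfderiv 𝓘(ℝ, ℂ) (𝓡 4) (fun ζ : ℂ => Φ (0, ζ)) z (1 : ℂ)) =
      D ((0 : ℂ), c) := fun c => by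
    rw [← mfderiv_apply_eq_jsmul JX hJ z c, hslice]
    rfl
  rw [hDζ t] at h
  by_cases hs : s = 0
  · subst hs
    rw [jsmul_zero_left, zero_add] at h
    have h0 : ((0 : ℂ), t) = 0 := hinj (h.trans (map_zero D).symm)
    exact ⟨rfl, (Prod.ext_iff.1 h0).2⟩
  · exfalso
    have h1 : jsmul JX (Φ (0, z)) s (D (1, 0)) = D (0, -t) := by
      rw [show ((0 : ℂ), -t) = -((0 : ℂ), t) by simp, map_neg]
      exact eq_neg_of_add_eq_zero_left h
    have h2 : D (1, 0) = D (0, s⁻¹ * -t) := by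
      have e1 : D (1, 0) = jsmul JX (Φ (0, z)) (s⁻¹ * s) (D (1, 0)) := by
        rw [inv_mul_cancel₀ hs, jsmul_one]
      rw [e1, jsmul_mul, h1, ← hDζ (-t), ← jsmul_mul, hDζ]
    have h3 : ((1 : ℂ), (0 : ℂ)) = ((0 : ℂ), s⁻¹ * -t) := hinj h2
    exact one_ne_zero (Prod.ext_iff.1 h3).1

variable {ε : ℝ} {U V : ℂ → ℂ → X}

/-- **The transverse field of a smooth two-parameter family is continuous**:
`z ↦ ⟨Φ(0, z), dΦ_{(0,z)}(1, 0)⟩` is continuous into `TX` for `Φ` smooth on `B_ε × ℂ`. [folklore] -/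
theorem continuous_paramLift {Φ : ℂ × ℂ → X} (hΦ : ContMDiffOn 𝓘(ℝ, ℂ × ℂ) (𝓡 4) ∞ Φ (ball 0 ε ×ˢ univ))
    (hε : 0 < ε) :
    Continuous fun z : ℂ =>
      (⟨Φ (0, z), mfderiv 𝓘(ℝ, ℂ × ℂ) (𝓡 4) Φ (0, z) ((1 : ℂ), (0 : ℂ))⟩ : TangentBundle (𝓡 4) X) := by
  have hs : IsOpen (ball (0 : ℂ) ε ×ˢ (univ : Set ℂ)) := isOpen_paramDomain ε
  have h1 : ContinuousOn (tangentMapWithin 𝓘(ℝ, ℂ × ℂ) (𝓡 4) Φ (ball 0 ε ×ˢ univ))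
      (TotalSpace.proj ⁻¹' (ball (0 : ℂ) ε ×ˢ (univ : Set ℂ))) :=
    hΦ.continuousOn_tangentMapWithin (by simp) hs.uniqueMDiffOn
  have h2 : Continuous fun z : ℂ =>
      (tangentBundleModelSpaceHomeomorph (H := ℂ × ℂ) 𝓘(ℝ, ℂ × ℂ)).symm (((0 : ℂ), z), ((1 : ℂ), (0 : ℂ))) :=
    (tangentBundleModelSpaceHomeomorph (H := ℂ × ℂ) 𝓘(ℝ, ℂ × ℂ)).symm.continuous.comp
      ((continuous_const.prodMk continuous_id).prodMk continuous_const)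
  have hε' : ‖(0 : ℂ)‖ < ε := by simpa using hε
  have h3 := h1.comp_continuous h2 fun z => mem_paramDomain (z := z) hε'
  refine h3.congr fun z => ?_
  change (⟨Φ (0, z), mfderivWithin 𝓘(ℝ, ℂ × ℂ) (𝓡 4) Φ (ball 0 ε ×ˢ univ) (0, z) ((1 : ℂ), (0 : ℂ))⟩ :
    TangentBundle (𝓡 4) X) = _
  rw [mfderivWithin_of_isOpen hs (mem_paramDomain hε')]

omit [IsManifold (𝓡 4) ∞ X] in
/-- **The transverse fields of the two charts of a family glue**: for `Φ_V(a, w) = Φ_U(a, w⁻¹)`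
(`w ≠ 0`), `dΦ_V(0, w)(1, 0) = dΦ_U(0, w⁻¹)(1, 0)` (chain rule; the reparametrisation fixes the
first variable). [folklore] -/
theorem paramLift_glue (hε : 0 < ε)
    (hUs : ContMDiffOn 𝓘(ℝ, ℂ × ℂ) (𝓡 4) ∞ (fun q : ℂ × ℂ => U q.1 q.2) (ball 0 ε ×ˢ univ))
    (hUV : ∀ a : ℂ, ‖a‖ < ε → ∀ z : ℂ, z ≠ 0 → V a z = U a z⁻¹) {w : ℂ} (hw : w ≠ 0) :
    mfderiv 𝓘(ℝ, ℂ × ℂ) (𝓡 4) (fun q : ℂ × ℂ => V q.1 q.2) (0, w) ((1 : ℂ), (0 : ℂ)) =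
      mfderiv 𝓘(ℝ, ℂ × ℂ) (𝓡 4) (fun q : ℂ × ℂ => U q.1 q.2) (0, w⁻¹) ((1 : ℂ), (0 : ℂ)) := by
  set ψ : ℂ × ℂ → ℂ × ℂ := fun q => (q.1, q.2⁻¹) with hψ
  have hev : (fun q : ℂ × ℂ => V q.1 q.2) =ᶠ[𝓝 (0, w)] ((fun q : ℂ × ℂ => U q.1 q.2) ∘ ψ) := by
    have hO : IsOpen (ball (0 : ℂ) ε ×ˢ {z : ℂ | z ≠ 0}) := isOpen_ball.prod isOpen_ne
    filter_upwards [hO.mem_nhds ⟨mem_ball_self hε, hw⟩] with q hq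
    exact hUV q.1 (by simpa using hq.1) q.2 hq.2
  rw [hev.mfderiv_eq]
  set L : ℂ × ℂ →L[ℝ] ℂ × ℂ := (ContinuousLinearMap.fst ℝ ℂ ℂ).prod
    ((((ContinuousLinearMap.toSpanSingleton ℂ (-(w ^ 2)⁻¹)).restrictScalars ℝ : ℂ →L[ℝ] ℂ)).comp
      (ContinuousLinearMap.snd ℝ ℂ ℂ)) with hL
  have hψd : HasMFDerivAt 𝓘(ℝ, ℂ × ℂ) 𝓘(ℝ, ℂ × ℂ) ψ (0, w) L := by
    have h1 : HasFDerivAt (fun q : ℂ × ℂ => q.2⁻¹)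
        ((((ContinuousLinearMap.toSpanSingleton ℂ (-(w ^ 2)⁻¹)).restrictScalars ℝ : ℂ →L[ℝ] ℂ)).comp
          (ContinuousLinearMap.snd ℝ ℂ ℂ)) ((0 : ℂ), w) :=
      ((hasDerivAt_inv hw).hasFDerivAt.restrictScalars ℝ).comp ((0 : ℂ), w) hasFDerivAt_snd
    exact (hasFDerivAt_fst.prodMk h1).hasMFDerivAt
  have hε' : ‖(0 : ℂ)‖ < ε := by simpa using hε
  have hUd : MDifferentiableAt 𝓘(ℝ, ℂ × ℂ) (𝓡 4) (fun q : ℂ × ℂ => U q.1 q.2) (ψ (0, w)) :=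
    (hUs.contMDiffAt ((isOpen_paramDomain ε).mem_nhds (mem_paramDomain hε'))).mdifferentiableAt (by simp)
  rw [mfderiv_comp (0, w) hUd hψd.mdifferentiableAt, hψd.mfderiv]
  change mfderiv 𝓘(ℝ, ℂ × ℂ) (𝓡 4) (fun q : ℂ × ℂ => U q.1 q.2) (ψ (0, w)) (L ((1 : ℂ), (0 : ℂ))) = _
  have hL1 : L ((1 : ℂ), (0 : ℂ)) = ((1 : ℂ), (0 : ℂ)) := by simp [hL]
  rw [hL1]

variable (hε : 0 < ε)
  (hleaf : ∀ a : ℂ, ‖a‖ < ε →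
    ContMDiff 𝓘(ℝ, ℂ) (𝓡 4) ∞ (U a) ∧ ContMDiff 𝓘(ℝ, ℂ) (𝓡 4) ∞ (V a) ∧
    (∀ z : ℂ, z ≠ 0 → V a z = U a z⁻¹) ∧
    IsJHolomorphic (𝓡 4) (fun y => JX y) (U a) ∧ IsJHolomorphic (𝓡 4) (fun y => JX y) (V a) ∧
    Injective (U a) ∧ (∀ z, Injective (mfderiv 𝓘(ℝ, ℂ) (𝓡 4) (U a) z)) ∧
    Injective (mfderiv 𝓘(ℝ, ℂ) (𝓡 4) (V a) 0) ∧ V a 0 ∉ range (U a))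
  (hUs : ContMDiffOn 𝓘(ℝ, ℂ × ℂ) (𝓡 4) ∞ (fun q : ℂ × ℂ => U q.1 q.2) (ball 0 ε ×ˢ univ))
  (hVs : ContMDiffOn 𝓘(ℝ, ℂ × ℂ) (𝓡 4) ∞ (fun q : ℂ × ℂ => V q.1 q.2) (ball 0 ε ×ˢ univ))
  (himm : ∀ q ∈ ball (0 : ℂ) ε ×ˢ (univ : Set ℂ),
    Injective (mfderiv 𝓘(ℝ, ℂ × ℂ) (𝓡 4) (fun q : ℂ × ℂ => U q.1 q.2) q) ∧
    Injective (mfderiv 𝓘(ℝ, ℂ × ℂ) (𝓡 4) (fun q : ℂ × ℂ => V q.1 q.2) q))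

include hε hleaf hUs hVs himm in
/-- **The glued map of the central leaf of a smooth family of immersed `J`-spheres is not
null-homotopic** (the `c₁`-step of Wendl 2018, proof of Prop. 2.53: the leaves have
`c₁([S]) = 2 ≠ 0`): `not_homotopic_const` with the transverse field `∂_a Φ_U(0, z)(1, 0)` of the
family. [cite: Wendl2018, Prop. 2.53 (proof)] [cite: McDuffSalamon2017, Thm. 2.7.1] -/
theorem not_homotopic_const_of_family {F₀ : C(ComplexProjectiveSpace 1, X)}
    (hF0 : ∀ p, CoordNeZero 0 p → F₀ p = U 0 (affineCoordComplex 0 p 0))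
    (hF1 : ∀ p, CoordNeZero 1 p → F₀ p = V 0 (affineCoordComplex 1 p 0))
    [T2Space X] [SecondCountableTopology X] (x₀ : X) :
    ¬ F₀.Homotopic (ContinuousMap.const (ComplexProjectiveSpace 1) x₀) := by
  have hε' : ‖(0 : ℂ)‖ < ε := by simpa using hε
  obtain ⟨hU0, hV0, hUV0, hJU0, hJV0, -, -, -, -⟩ := hleaf 0 hε'
  have hq : ∀ z : ℂ, ((0 : ℂ), z) ∈ ball (0 : ℂ) ε ×ˢ (univ : Set ℂ) := fun z => mem_paramDomain hε'
  refine not_homotopic_const JX (u := U 0) (v := V 0)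
    (ξu := fun z => mfderiv 𝓘(ℝ, ℂ × ℂ) (𝓡 4) (fun q : ℂ × ℂ => U q.1 q.2) (0, z) ((1 : ℂ), (0 : ℂ)))
    (ξv := fun w => mfderiv 𝓘(ℝ, ℂ × ℂ) (𝓡 4) (fun q : ℂ × ℂ => V q.1 q.2) (0, w) ((1 : ℂ), (0 : ℂ)))
    (hU0.of_le (by simp)) (hV0.of_le (by simp)) hUV0 hJU0 hF0 hF1
    (continuous_paramLift hUs hε) (continuous_paramLift hVs hε)
    (fun w hw => paramLift_glue hε hUs (fun a ha => (hleaf a ha).2.2.1) hw)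
    (fun z s t h => ?_) (fun w s t h => ?_) x₀
  · exact indep_of_injective_mfderiv JX (Φ := fun q : ℂ × ℂ => U q.1 q.2) (himm _ (hq z)).1 hJU0
      (fun ζ => mfderiv_slice_apply hUs hε' ζ) s t h
  · exact indep_of_injective_mfderiv JX (Φ := fun q : ℂ × ℂ => V q.1 q.2) (himm _ (hq w)).2 hJV0
      (fun ζ => mfderiv_slice_apply hVs hε' ζ) s t h

end Family

end JSphereNullHomotopy

/-! ### The uniqueness clause without the non-constancy hypothesis -/

section Uniqueness

variable {X : Type} [TopologicalSpace X] [T2Space X] [SecondCountableTopology X]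
  [ChartedSpace (EuclideanSpace ℝ (Fin 4)) X] [IsManifold (𝓡 4) ∞ X]
  {JX : AlmostComplexStructure (𝓡 4) ∞ X} {ε : ℝ} {U V : ℂ → ℂ → X}

variable (hε : 0 < ε)
  (hleaf : ∀ a : ℂ, ‖a‖ < ε →
    ContMDiff 𝓘(ℝ, ℂ) (𝓡 4) ∞ (U a) ∧ ContMDiff 𝓘(ℝ, ℂ) (𝓡 4) ∞ (V a) ∧
    (∀ z : ℂ, z ≠ 0 → V a z = U a z⁻¹) ∧
    IsJHolomorphic (𝓡 4) (fun y => JX y) (U a) ∧ IsJHolomorphic (𝓡 4) (fun y => JX y) (V a) ∧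
    Injective (U a) ∧ (∀ z, Injective (mfderiv 𝓘(ℝ, ℂ) (𝓡 4) (U a) z)) ∧
    Injective (mfderiv 𝓘(ℝ, ℂ) (𝓡 4) (V a) 0) ∧ V a 0 ∉ range (U a))
  (hUs : ContMDiffOn 𝓘(ℝ, ℂ × ℂ) (𝓡 4) ∞ (fun q : ℂ × ℂ => U q.1 q.2) (ball 0 ε ×ˢ univ))
  (hVs : ContMDiffOn 𝓘(ℝ, ℂ × ℂ) (𝓡 4) ∞ (fun q : ℂ × ℂ => V q.1 q.2) (ball 0 ε ×ˢ univ))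
  (hdisj : ∀ a a' : ℂ, ‖a‖ < ε → ‖a'‖ < ε → a ≠ a' →
    Disjoint (range (U a) ∪ {V a 0}) (range (U a') ∪ {V a' 0}))
  (himm : ∀ q ∈ ball (0 : ℂ) ε ×ˢ (univ : Set ℂ),
    Injective (mfderiv 𝓘(ℝ, ℂ × ℂ) (𝓡 4) (fun q : ℂ × ℂ => U q.1 q.2) q) ∧
    Injective (mfderiv 𝓘(ℝ, ℂ × ℂ) (𝓡 4) (fun q : ℂ × ℂ => V q.1 q.2) q))

include hε hleaf hdisj hUs hVs himm in
/-- **The uniqueness clause of the Hofer–Lizan–Sikorav local foliation, exactly as in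
`hls_localFoliation_embeddedSphere_trivialNormal`, from the family data** (Wendl 2018,
Prop. 2.53 with Thm. 2.49): every `JX`-holomorphic two-chart sphere whose glued map is homotopic
to that of the central leaf and which meets the swept set is a leaf. This is
`hls_uniqueness_of_localFamily` with its non-constancy hypothesis removed: a constant sphere has
a constant glued map, which cannot be homotopic to the glued map of the central leaf
(`JSphereNullHomotopy.not_homotopic_const_of_family`, `c₁ = 2 ≠ 0`).
[cite: Wendl2018, Prop. 2.53 and Thm. 2.49] -/
theorem hls_uniqueness_of_localFamily'
    {u₀ v₀ : ℂ → X} (hU0 : ∀ z, U 0 z = u₀ z) (hV0 : ∀ w, V 0 w = v₀ w)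
    {u v : ℂ → X} {F F₀ : C(ComplexProjectiveSpace 1, X)}
    (hu : ContMDiff 𝓘(ℝ, ℂ) (𝓡 4) ∞ u) (hv : ContMDiff 𝓘(ℝ, ℂ) (𝓡 4) ∞ v)
    (huv : ∀ z : ℂ, z ≠ 0 → v z = u z⁻¹) (hJu : IsJHolomorphic (𝓡 4) (fun y => JX y) u)
    (hJv : IsJHolomorphic (𝓡 4) (fun y => JX y) v)
    (hF0 : ∀ p, CoordNeZero 0 p → F p = u (affineCoordComplex 0 p 0))
    (hF1 : ∀ p, CoordNeZero 1 p → F p = v (affineCoordComplex 1 p 0))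
    (hF₀0 : ∀ p, CoordNeZero 0 p → F₀ p = u₀ (affineCoordComplex 0 p 0))
    (hF₀1 : ∀ p, CoordNeZero 1 p → F₀ p = v₀ (affineCoordComplex 1 p 0))
    (hhom : F.Homotopic F₀)
    (hmeet : ∃ z a, ‖a‖ < ε ∧ u z ∈ range (U a) ∪ {V a 0}) :
    ∃ a, ‖a‖ < ε ∧ range u ∪ {v 0} = range (U a) ∪ {V a 0} := by
  by_cases hnc : ∃ z, u z ≠ u 0
  · exact hls_uniqueness_of_localFamily hε hleaf hUs hVs hdisj himm hU0 hV0 hu hv huv hJu hJv hF0 hF1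
      hF₀0 hF₀1 hhom hmeet hnc
  · exfalso
    have huc : ∀ z, u z = u 0 := fun z => by
      by_contra h
      exact hnc ⟨z, h⟩
    -- `v` is constant as well
    have hvc : ∀ w, v w = u 0 := by
      have hcl : IsClosed {w : ℂ | v w = u 0} := isClosed_eq hv.continuous continuous_const
      have hsub : ({0}ᶜ : Set ℂ) ⊆ {w : ℂ | v w = u 0} := fun w hw => by
        change v w = u 0
        rw [huv w hw, huc]
      have huniv : (univ : Set ℂ) ⊆ {w : ℂ | v w = u 0} := by
        rw [← (dense_compl_singleton (0 : ℂ)).closure_eq]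
        exact hcl.closure_subset_iff.2 hsub
      exact fun w => huniv (mem_univ w)
    -- hence `F` is constant
    have hF : F = ContinuousMap.const (ComplexProjectiveSpace 1) (u 0) := by
      ext p
      by_cases hp : CoordNeZero 0 p
      · rw [hF0 p hp, huc]; rfl
      · rw [hF1 p (coordNeZero_one_of_not_coordNeZero_zero hp), hvc]; rfl
    have hhom' : F₀.Homotopic (ContinuousMap.const (ComplexProjectiveSpace 1) (u 0)) := by
      rw [← hF]; exact hhom.symm
    have hF₀0' : ∀ p, CoordNeZero 0 p → F₀ p = U 0 (affineCoordComplex 0 p 0) := fun p hp => by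
      rw [hU0]; exact hF₀0 p hp
    have hF₀1' : ∀ p, CoordNeZero 1 p → F₀ p = V 0 (affineCoordComplex 1 p 0) := fun p hp => by
      rw [hV0]; exact hF₀1 p hp
    exact JSphereNullHomotopy.not_homotopic_const_of_family JX hε hleaf hUs hVs himm hF₀0' hF₀1' (u 0) hhom'

end Uniqueness

end Literature.Geometry.Symplectic

end
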